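import Summits.ResolutionOfSingularities.ResolutionOfSingularities.Theorems.SeparableGaloisGaloisQuotientModelsDefs
import Literature.AlgebraicGeometry.Motives.RatFnSpec
import HarnessLib

/-!
# Crux `GaloisQuotientModels` (stmt-ResolutionOfSingularities-18955), line `inseparability-foliation-quotient`:
# stub `stub_frobeniusCompositum`

Route `ResolutionOfSingularities/SeparableGalois`; registered stub of the line skeleton
`Cruxes/GaloisQuotientModels/Lines/inseparability_foliation_quotient.lean` (lead's reshape, 2026-08-17).
Vocabulary: `Theorems/SeparableGaloisGaloisQuotientModelsDefs.lean` (`frobeniusCompositum`).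

## Statement

Let `π : X₁ → X` be a dominant morphism of integral schemes with `char K(X₁) = p`, let the finite
group `G` act on `X₁` by `ρ` over `X` (`(ρ g).hom ≫ π = π`), and suppose the defect
`K := π♯ K(X) ⊆ K(X₁)^G` is purely inseparable of exponent `≤ n` (`a ∈ K(X₁)^G ⇒ a^{pⁿ} ∈ K`).
Put `L := K(X₁)` and `Mₙ := frobeniusCompositum π p n = closure (K ∪ {a^{pⁿ}}) = K·L^{pⁿ}`. Then
(1) `Mₙ` is stable under every `(ρ g)♯`, and (2) `Mₙ ∩ L^G ⊆ K`: an element of `Mₙ` fixed by all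
`(ρ g)♯` lies in `π♯ K(X)` (de Jong 1997, 5.3 (d): dividing out the purely inseparable defect of a
Galois alteration at the level of function fields).

## Proof

* `sandwich_iterateFrobenius` — the abstract level-`n` Frobenius sandwich (the `n = 1` case is the
  landed `InseparabilityFoliation.stub_sandwich`): a finite group `G` acting on a field `L` of
  characteristic `p`, `K₁ := L^G`, `K₂ ≤ K₁` with `K₁^{pⁿ} ⊆ K₂`, `L₂ := K₂ ⊔ L^{pⁿ}`
  (`L^{pⁿ} = (iterateFrobenius L p n).fieldRange`). Stability: the preimage of `L₂` under `a ↦ g • a`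
  contains `K₂` (fixed pointwise) and `L^{pⁿ}` (`g • b^{pⁿ} = (g • b)^{pⁿ}`). `L₂ ⊓ K₁ = K₂`: every
  `b^{pⁿ}` is separable over `K₂` — push the separable (Artin: `L / L^G` is separable, Mathlib
  `FixedPoints.isSeparable`, no faithfulness needed) minimal polynomial of `b` over `K₁` through the
  ring map `K₁ → K₂, e ↦ e^{pⁿ}`; so `L₂ ≤ separableClosure K₂ L`, while `K₁ ≤ perfectClosure K₂ L`,
  and `separableClosure ⊓ perfectClosure = ⊥`.
* Transport: `g ↦ (ρ g)♯ := functionFieldMap (ρ g).hom` is an ANTI-homomorphism `G → End K(X₁)`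
  (`functionFieldMap_comp`, `functionFieldMap_id`), i.e. a monoid hom from `Gᵐᵒᵖ`;
  through it `Gᵐᵒᵖ` acts on `L` (`MulSemiringAction.compHom`) with fixed field
  `{a | ∀ g, (ρ g)♯ a = a}`; `K₂ := (π♯).fieldRange` is fixed since `(ρ g).hom ≫ π = π`, and
  `Mₙ = K₂ ⊔ (iterateFrobenius L p n).fieldRange` (`Subfield.closure_union`, `Subfield.closure_eq`).

Sources: A. J. de Jong, *Families of curves and alterations*, Ann. Inst. Fourier 47 (1997), 5.3 (d),
Thm. 5.13 [DeJong1997]; the field theory is folklore (Artin's theorem + "separable ∩ purely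
inseparable = base"). No named facts are used.
-/

noncomputable section

-- single-problem summit: the doubled namespace component `ResolutionOfSingularities` is forced
set_option linter.dupNamespace false

open CategoryTheory AlgebraicGeometry TopologicalSpace
open Literature.AlgebraicGeometry.Resolution
open Literature.AlgebraicGeometry.Motives Literature.AlgebraicGeometry.Motives.RatFn

namespace Summit.ResolutionOfSingularities.ResolutionOfSingularities.Theorems.GaloisQuotientModels

/-! ### The level-`n` Frobenius sandwich (pure field theory) -/

open Polynomial in
/-- **Level-`n` Frobenius sandwich.** `G` a finite group acting on a field `L` of characteristic
`p` (not necessarily faithfully), `K₁ = L^G = FixedPoints.subfield G L`, `K₂ ≤ K₁` a subfield with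
`K₁^{pⁿ} ⊆ K₂`, `L₂ := K₂ ⊔ L^{pⁿ}` with `L^{pⁿ} = (iterateFrobenius L p n).fieldRange`. Then `L₂`
is `G`-stable and `L₂ ⊓ K₁ = K₂`. Proof: stability is `g • b^{pⁿ} = (g • b)^{pⁿ}`; for the
intersection, `L₂` is separable over `K₂` (the image under `K₁ → K₂, e ↦ e^{pⁿ}` of the separable
minimal polynomial of `b` over `K₁ = L^G` kills `b^{pⁿ}`) while `K₁` is purely inseparable over
`K₂`, and `separableClosure K₂ L ⊓ perfectClosure K₂ L = ⊥`. The case `n = 1` is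
`InseparabilityFoliation.stub_sandwich`. [folklore] -/
theorem sandwich_iterateFrobenius (p n : ℕ) [Fact p.Prime] (L : Type*) [Field L] [CharP L p]
    (G : Type*) [Group G] [Finite G] [MulSemiringAction G L]
    (K₂ : Subfield L) (hK₂ : K₂ ≤ FixedPoints.subfield G L)
    (hpow : ∀ a ∈ FixedPoints.subfield G L, a ^ p ^ n ∈ K₂) :
    (∀ g : G, ∀ a ∈ K₂ ⊔ (iterateFrobenius L p n).fieldRange,
      g • a ∈ K₂ ⊔ (iterateFrobenius L p n).fieldRange) ∧
    (K₂ ⊔ (iterateFrobenius L p n).fieldRange) ⊓ FixedPoints.subfield G L = K₂ := by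
  set L₂ : Subfield L := K₂ ⊔ (iterateFrobenius L p n).fieldRange
  refine ⟨fun g => ?_, le_antisymm ?_ (le_inf le_sup_left hK₂)⟩
  · -- `G`-stability: `L₂` lies in its preimage under the ring endomorphism `a ↦ g • a`
    have h : L₂ ≤ L₂.comap (MulSemiringAction.toRingHom G L g) := by
      refine sup_le (fun a ha => ?_) ?_
      · rw [Subfield.mem_comap, MulSemiringAction.toRingHom_apply, hK₂ ha g]
        exact (le_sup_left : K₂ ≤ L₂) ha
      · rintro _ ⟨b, rfl⟩
        rw [Subfield.mem_comap, MulSemiringAction.toRingHom_apply, iterateFrobenius_def, smul_pow']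
        exact (le_sup_right : (iterateFrobenius L p n).fieldRange ≤ L₂) ⟨g • b, rfl⟩
    exact fun a ha => h ha
  · -- `L₂ ⊓ K₁ ≤ K₂`: separable meets purely inseparable
    rintro x ⟨hx₂, hx₁⟩
    have hsep : L₂ ≤ (separableClosure K₂ L).toSubfield := by
      refine sup_le (fun a ha => ?_) ?_
      · rw [IntermediateField.mem_toSubfield, mem_separableClosure_iff]
        exact isSeparable_algebraMap (⟨a, ha⟩ : K₂)
      · rintro _ ⟨b, rfl⟩
        rw [IntermediateField.mem_toSubfield, mem_separableClosure_iff]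
        -- the `pⁿ`-th power map `K₁ → K₂`, `e ↦ e ^ p ^ n`
        let φ : FixedPoints.subfield G L →+* K₂ :=
          ((iterateFrobenius L p n).comp (FixedPoints.subfield G L).subtype).codRestrict K₂
            fun e => hpow e e.2
        have hφ : (algebraMap K₂ L).comp φ =
            (iterateFrobenius L p n).comp (algebraMap (FixedPoints.subfield G L) L) :=
          RingHom.ext fun _ => rfl
        have hf : (minpoly (FixedPoints.subfield G L) b).Separable :=
          Algebra.IsSeparable.isSeparable _ b
        have hroot : aeval (iterateFrobenius L p n b)
            ((minpoly (FixedPoints.subfield G L) b).map φ) = 0 := by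
          rw [aeval_def, eval₂_map, hφ, ← hom_eval₂, ← aeval_def, minpoly.aeval, map_zero]
        exact hf.map.of_dvd (minpoly.dvd K₂ _ hroot)
    have h₁ : x ∈ separableClosure K₂ L := hsep hx₂
    have h₂ : x ∈ perfectClosure K₂ L :=
      (mem_perfectClosure_iff_pow_mem p).2 ⟨n, ⟨x ^ p ^ n, hpow x hx₁⟩, rfl⟩
    have h₃ : x ∈ separableClosure K₂ L ⊓ perfectClosure K₂ L :=
      IntermediateField.mem_inf.2 ⟨h₁, h₂⟩
    rw [separableClosure_inf_perfectClosure, IntermediateField.mem_bot] at h₃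
    obtain ⟨y, rfl⟩ := h₃
    exact y.2

/-! ### Functoriality of `K(X₁)` under `ρ : G →* Aut X₁` -/

section Action

universe u

variable {G : Type*} [Group G] {X₁ : Scheme.{u}} [IsIntegral X₁]

/-- `(ρ 1)♯ = id` on the function field (`(ρ 1).hom = 𝟙 X₁` and `functionFieldMap_id`).
[folklore] -/
theorem functionFieldMap_aut_one (ρ : G →* Aut X₁) (a : X₁.functionField) :
    functionFieldMap (ρ 1).hom a = a := by
  rw [functionFieldMap_congr (show (ρ 1).hom = 𝟙 X₁ by rw [map_one]; rfl), functionFieldMap_id,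
    RingHom.id_apply]

/-- `(ρ (g * h))♯ = (ρ h)♯ ∘ (ρ g)♯` on the function field: `(ρ g * ρ h).hom = (ρ h).hom ≫ (ρ g).hom`
in `Aut X₁` and `functionFieldMap` is contravariant (`functionFieldMap_comp`). [folklore] -/
theorem functionFieldMap_aut_mul (ρ : G →* Aut X₁) (g h : G) (a : X₁.functionField) :
    functionFieldMap (ρ (g * h)).hom a =
      functionFieldMap (ρ h).hom (functionFieldMap (ρ g).hom a) := by
  rw [functionFieldMap_congr (show (ρ (g * h)).hom = (ρ h).hom ≫ (ρ g).hom by rw [map_mul]; rfl),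
    functionFieldMap_comp, RingHom.comp_apply]

end Action

/-! ### The stub -/

/-- **Stub `stub_frobeniusCompositum`** (line `inseparability-foliation-quotient`, field-theoretic
step of de Jong 1997, 5.3 (d)). For a dominant `π : X₁ → X` of integral schemes with
`char K(X₁) = p`, a finite group `G` acting on `X₁` over `X` through `ρ`, and defect of exponent
`≤ n` (`a ∈ K(X₁)^G ⇒ a^{pⁿ} ∈ π♯ K(X)`), the Frobenius compositum
`Mₙ = frobeniusCompositum π p n = π♯K(X) · K(X₁)^{pⁿ}` is (1) stable under every `(ρ g)♯` and
(2) satisfies `Mₙ ∩ K(X₁)^G ⊆ π♯ K(X)`. Proof: let `Gᵐᵒᵖ` act on `L = K(X₁)` through the monoid hom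
`op g ↦ (ρ g)♯`; its fixed field is `{a | ∀ g, (ρ g)♯ a = a} ⊇ K₂ := (π♯).fieldRange`
(`(ρ g).hom ≫ π = π`), `Mₙ = K₂ ⊔ (iterateFrobenius L p n).fieldRange`, and both claims are
`sandwich_iterateFrobenius` (Artin + separable ∩ purely inseparable = base).
[cite: DeJong1997, 5.3 (d) and Thm. 5.13] -/
theorem stub_frobeniusCompositum (p n : ℕ) [Fact p.Prime] (G : Type) [Group G] [Finite G]
    (X₁ X : Scheme.{0}) [IsIntegral X₁] [IsIntegral X] [CharP X₁.functionField p]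
    (ρ : G →* Aut X₁) (π : X₁ ⟶ X) [IsDominant π] (hinv : ∀ g : G, (ρ g).hom ≫ π = π)
    (hpow : ∀ a : X₁.functionField, (∀ g : G, functionFieldMap (ρ g).hom a = a) →
      a ^ p ^ n ∈ Set.range (functionFieldMap π)) :
    (∀ (g : G) (a : X₁.functionField), a ∈ frobeniusCompositum π p n →
      functionFieldMap (ρ g).hom a ∈ frobeniusCompositum π p n) ∧
    (∀ a : X₁.functionField, a ∈ frobeniusCompositum π p n →
      (∀ g : G, functionFieldMap (ρ g).hom a = a) → a ∈ Set.range (functionFieldMap π)) := by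
  -- `g ↦ (ρ g)♯` is an anti-homomorphism `G → End K(X₁)`, i.e. a monoid hom `σ` from `Gᵐᵒᵖ`,
  -- through which `Gᵐᵒᵖ` acts on `L = K(X₁)`
  haveI : Finite Gᵐᵒᵖ := Finite.of_equiv G MulOpposite.opEquiv
  let σ : Gᵐᵒᵖ →* (X₁.functionField →+* X₁.functionField) :=
    { toFun := fun g => functionFieldMap (ρ (MulOpposite.unop g)).hom
      map_one' := RingHom.ext fun a => functionFieldMap_aut_one ρ a
      map_mul' := fun x y => RingHom.ext fun a =>
        functionFieldMap_aut_mul ρ (MulOpposite.unop y) (MulOpposite.unop x) a }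
  letI : MulSemiringAction Gᵐᵒᵖ X₁.functionField :=
    MulSemiringAction.compHom X₁.functionField σ
  -- its fixed field is `{a | ∀ g, (ρ g)♯ a = a}`
  have hfix : ∀ a : X₁.functionField,
      a ∈ FixedPoints.subfield Gᵐᵒᵖ X₁.functionField ↔
        ∀ g : G, functionFieldMap (ρ g).hom a = a :=
    fun a => ⟨fun h g => h (MulOpposite.op g), fun h g => h (MulOpposite.unop g)⟩
  -- `K₂ := π♯ K(X)` is fixed pointwise, since `(ρ g).hom ≫ π = π`
  have hK : ∀ (g : G) (b : X.functionField),
      functionFieldMap (ρ g).hom (functionFieldMap π b) = functionFieldMap π b := fun g b => by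
    rw [← RingHom.comp_apply (functionFieldMap (ρ g).hom), ← functionFieldMap_comp π (ρ g).hom,
      functionFieldMap_congr (hinv g)]
  have hK₂ : (functionFieldMap π).fieldRange ≤ FixedPoints.subfield Gᵐᵒᵖ X₁.functionField := by
    rintro _ ⟨b, rfl⟩ g
    exact hK (MulOpposite.unop g) b
  have hpow' : ∀ a ∈ FixedPoints.subfield Gᵐᵒᵖ X₁.functionField,
      a ^ p ^ n ∈ (functionFieldMap π).fieldRange :=
    fun a ha => hpow a ((hfix a).1 ha)
  obtain ⟨hstab, hinf⟩ := sandwich_iterateFrobenius p n X₁.functionField Gᵐᵒᵖ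
    (functionFieldMap π).fieldRange hK₂ hpow'
  -- `Mₙ = K₂ ⊔ L^{pⁿ}`
  have hrange : (Set.range fun a : X₁.functionField => a ^ p ^ n) =
      ((iterateFrobenius X₁.functionField p n).fieldRange : Set X₁.functionField) := rfl
  have hM : frobeniusCompositum π p n =
      (functionFieldMap π).fieldRange ⊔ (iterateFrobenius X₁.functionField p n).fieldRange := by
    rw [frobeniusCompositum, Subfield.closure_union, ← RingHom.coe_fieldRange (functionFieldMap π),
      hrange, Subfield.closure_eq, Subfield.closure_eq]
  refine ⟨fun g a ha => ?_, fun a ha hfixa => ?_⟩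
  · rw [hM] at ha ⊢
    exact hstab (MulOpposite.op g) a ha
  · have h : a ∈ (functionFieldMap π).fieldRange := by
      rw [← hinf]
      exact Subfield.mem_inf.2 ⟨hM ▸ ha, (hfix a).2 hfixa⟩
    obtain ⟨b, hb⟩ := h
    exact ⟨b, hb⟩

end Summit.ResolutionOfSingularities.ResolutionOfSingularities.Theorems.GaloisQuotientModels

end
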